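import Summits.PneNP.PneNP.Theses.DelsarteLasserre
import Literature.Combinatorics.SimpleGraph.LasserreFiniteConvergence

/-!
# PneNP / DelsarteLasserre — `LasserreFiniteConvergence` (stmt-PneNP-2133)

Route `PneNP/DelsarteLasserre`, support item stmt-PneNP-2133: finite convergence of Lasserre's
hierarchy for the stability number, specialised to the Hamming conflict graphs
`H(n,d) = SimpleGraph.fromRel (fun u v : Fin n → Bool => hammingDist u v < d)` in the route's
inline formulation (moment matrix indexed by the sets of size `≤ t`, `y_∅ = 1`, `y ≥ 0`,
`y_{uv} = 0` on conflict edges): if `α(H(n,d)) ≤ t` then every level-`t` feasible `y` has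
`Σ_v y_{v} ≤ α(H(n,d))`.

This is Laurent's theorem (M. Laurent, Math. Oper. Res. 28 (2003), §5 with §3.1 Lemma 2 (ii) and
§6.1 Prop. 21; quoted in M. Laurent, Math. Program. 109 (2007), §3.1 p. 248: "`α(G) ≤ las⁽ᵏ⁾(G)`,
with equality if `k ≥ α(G)`"), which the tree vendors as the named fact
`Literature.Combinatorics.SimpleGraph.Laurent2003_lasserre_exact_of_indepNum_le` and DISCHARGES
(`…_holds`, Möbius inversion on the Boolean lattice); the route-shaped corollary
`sum_singleton_le_indepNum_of_inline` has exactly the item's hypotheses. The proof below is the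
instantiation `V := Fin n → Bool`, `r := (hammingDist · · < d)` — unconditional.
-/

set_option linter.dupNamespace false -- `Summit.PneNP.PneNP.…`: summit = sub-problem name (D-0017 single-conjunct layout)

namespace Summit.PneNP.PneNP.Theorems

/-- **Finite convergence of the Lasserre hierarchy on the Hamming conflict graphs** (route
DelsarteLasserre, item stmt-PneNP-2133 `LasserreFiniteConvergence`): if `α(H(n,d)) ≤ t` then every
`y` with `y ∅ = 1`, `y ≥ 0`, `y {u,v} = 0` for `u ≠ v` at Hamming distance `< d`, and positive
semidefinite level-`t` moment matrix satisfies `Σ_v y {v} ≤ α(H(n,d))`. Instance of Laurent's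
finite-convergence theorem, proved in the tree
(`Laurent2003_lasserre_exact_of_indepNum_le_holds`). [cite: Laurent2003, §5; Laurent2006, §3.1 p. 248] -/
theorem delsarteLasserre_lasserreFiniteConvergence_proof :
    Summit.PneNP.PneNP.Theses.DelsarteLasserre.LasserreFiniteConvergence := by
  unfold Summit.PneNP.PneNP.Theses.DelsarteLasserre.LasserreFiniteConvergence
  intro n d t hα y h0 hnn hE hpsd
  exact Literature.Combinatorics.SimpleGraph.sum_singleton_le_indepNum_of_inline
    Literature.Combinatorics.SimpleGraph.Laurent2003_lasserre_exact_of_indepNum_le_holds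
    (fun u v : Fin n → Bool => hammingDist u v < d) t hα y h0 hnn hE hpsd

end Summit.PneNP.PneNP.Theorems
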